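import Mathlib.Analysis.SpecialFunctions.Gamma.Beta
import Mathlib.Analysis.SpecialFunctions.Pow.Real
import Mathlib.Analysis.SpecialFunctions.Trigonometric.Basic
import Mathlib.Tactic.LinearCombination
import Literature.Analysis.SpecialFunctions.GammaMultiplication
import HarnessLib

/-!
# An `ε`-type period constant on the Fermat surface of degree 12 (proved value)

Topic: `Literature/Analysis/SpecialFunctions`. Deligne's normalised period constant of a Hodge
character `a` of the Fermat hypersurface `X^n_d` is `Γ̃(a) = (2πi)^{-⟨a⟩} ∏ᵢ Γ(aᵢ/d)`
(Deligne, LNM 900, I §7, Thm. 7.15: algebraic, generating an abelian extension of `ℚ(ζ_d)`).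
For the degree-12 Fermat SURFACE (`n = 2`, `⟨a⟩ = 2`) the character class `a = (1,4,9,10)` is one of
the two `(ℤ/12)^×`-orbits of Hodge classes whose symbol is NOT in the lattice spanned by the
reflection and distribution (Gauss multiplication) relations — only twice the symbol is (the
2-torsion phenomenon of the universal distribution: Das, *Algebraic Gamma monomials and double
coverings of cyclotomic fields*, Trans. AMS 352 (2000); Kubert). Consequently the relation
machinery determines `Γ̃(a)²`, and `Γ̃(a)` itself is a square root of an element of the
Kummer field: here a FOURTH ROOT OF THE FUNDAMENTAL UNIT `2 + √3` of `ℚ(√3)` appears,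
`Γ̃(1,4,9,10)² = (√3+1)·2^{1/6}/(2·3^{1/4}) = (2+√3)^{1/2}·2^{-1/3}·3^{-1/4}`, `Γ̃ < 0`.

This file PROVES (kernel certificate for the pub-hlocus `ABSHODGE` table, engine A's relation
certificate `2m = 2R₂ + R₃ + R₄ − R₅ + D_{2,1} − D_{2,2} + D_{3,1}` turned into Mathlib's
reflection / Legendre duplication and the tree's Gauss multiplication formula for `n = 3`):

  `(Γ(1/12) Γ(4/12) Γ(9/12) Γ(10/12))² = 8 (√3 + 1) · 2^{1/6} / 3^{1/4} · π⁴`,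

and the normalised statements `Γ̃² = (√3+1)·2^{1/6}/(2·3^{1/4})`, `Γ̃ = −√(…)`.

## Sources

* P. Deligne, *Hodge cycles on abelian varieties*, LNM 900 (1982), I §7, Thm. 7.15.
* P. Das, *Algebraic Gamma monomials and double coverings of cyclotomic fields*,
  Trans. Amer. Math. Soc. 352 (2000), 3557–3594, §1 (the 2-torsion example `[1/3]+[2/15]-[4/15]-[1/5]`).
* G. E. Andrews, R. Askey, R. Roy, *Special Functions*, CUP 1999, Thm. 1.5.2 (Gauss multiplication;
  in the tree as `GaussMultiplication.real_formula`).
-/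

noncomputable section

open scoped Real

namespace Literature.Analysis.SpecialFunctions

/-- `(Γ(1/12)·Γ(4/12)·Γ(9/12)·Γ(10/12))² = 8(√3+1)·2^{1/6}·3^{-1/4}·π⁴`.
[cite: Deligne1982HodgeCycles, I Thm. 7.15] [cite: AndrewsAskeyRoy1999, Thm 1.5.2] -/
theorem Real_Gamma_prod_fermat12_1_4_9_10_sq :
    (Real.Gamma (1 / 12) * Real.Gamma (4 / 12) * Real.Gamma (9 / 12) * Real.Gamma (10 / 12)) ^ 2 =
      8 * (Real.sqrt 3 + 1) * (2 : ℝ) ^ ((1 : ℝ) / 6) / (3 : ℝ) ^ ((1 : ℝ) / 4) * π ^ 4 := by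
  rw [show (4 / 12 : ℝ) = 1 / 3 by norm_num, show (9 / 12 : ℝ) = 3 / 4 by norm_num,
    show (10 / 12 : ℝ) = 5 / 6 by norm_num]
  -- reflections R₂, R₃, R₄, R₅ (c/12 with c = 2,3,4,5)
  have hR2 := Real.Gamma_mul_Gamma_one_sub (1 / 6 : ℝ)
  rw [show (1 : ℝ) - 1 / 6 = 5 / 6 by norm_num, show π * (1 / 6 : ℝ) = π / 6 by ring,
    Real.sin_pi_div_six] at hR2
  have hR3 := Real.Gamma_mul_Gamma_one_sub (1 / 4 : ℝ)
  rw [show (1 : ℝ) - 1 / 4 = 3 / 4 by norm_num, show π * (1 / 4 : ℝ) = π / 4 by ring,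
    Real.sin_pi_div_four] at hR3
  have hR4 := Real.Gamma_mul_Gamma_one_sub (1 / 3 : ℝ)
  rw [show (1 : ℝ) - 1 / 3 = 2 / 3 by norm_num, show π * (1 / 3 : ℝ) = π / 3 by ring,
    Real.sin_pi_div_three] at hR4
  have hR5 := Real.Gamma_mul_Gamma_one_sub (5 / 12 : ℝ)
  rw [show (1 : ℝ) - 5 / 12 = 7 / 12 by norm_num, show π * (5 / 12 : ℝ) = π / 4 + π / 6 by ring,
    Real.sin_add, Real.sin_pi_div_four, Real.cos_pi_div_six, Real.cos_pi_div_four,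
    Real.sin_pi_div_six] at hR5
  -- Legendre duplications D_{2,1} (s = 1/12) and D_{2,2} (s = 1/6)
  have hD21 := Real.Gamma_mul_Gamma_add_half (1 / 12 : ℝ)
  rw [show (1 : ℝ) - 2 * (1 / 12) = 5 / 6 by norm_num, show (2 : ℝ) * (1 / 12) = 1 / 6 by norm_num,
    show (1 / 12 : ℝ) + 1 / 2 = 7 / 12 by norm_num] at hD21
  have hD22 := Real.Gamma_mul_Gamma_add_half (1 / 6 : ℝ)
  rw [show (1 : ℝ) - 2 * (1 / 6) = 2 / 3 by norm_num, show (2 : ℝ) * (1 / 6) = 1 / 3 by norm_num,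
    show (1 / 6 : ℝ) + 1 / 2 = 2 / 3 by norm_num] at hD22
  -- split 2^{5/6} = 2^{1/6} · 2^{2/3}
  rw [show (2 : ℝ) ^ ((5 : ℝ) / 6) = (2 : ℝ) ^ ((1 : ℝ) / 6) * (2 : ℝ) ^ ((2 : ℝ) / 3) by
    rw [← Real.rpow_add (by norm_num : (0 : ℝ) < 2)]; norm_num] at hD21
  -- Gauss triplication D_{3,1} (n = 3, x = 1/12), from the tree
  have h3 := GaussMultiplication.real_formula (n := 3) (by norm_num) (show (0 : ℝ) < 1 / 12 by norm_num)
  simp only [GaussMultiplication.prodGamma, Finset.prod_range_succ, Finset.prod_range_zero, one_mul,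
    Nat.cast_zero, Nat.cast_one, Nat.cast_ofNat, zero_div, add_zero] at h3
  norm_num at h3
  -- positivity facts, then name the atoms
  have hF := (Real.Gamma_pos_of_pos (by norm_num : (0 : ℝ) < 1 / 6)).ne'
  have hK := (Real.Gamma_pos_of_pos (by norm_num : (0 : ℝ) < 1 / 3)).ne'
  have hG := (Real.Gamma_pos_of_pos (by norm_num : (0 : ℝ) < 1 / 4)).ne'
  have hB := (Real.Gamma_pos_of_pos (by norm_num : (0 : ℝ) < 5 / 12)).ne'
  have hE := (Real.Gamma_pos_of_pos (by norm_num : (0 : ℝ) < 7 / 12)).ne'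
  have ht : (3 : ℝ) ^ ((1 : ℝ) / 4) ≠ 0 := (Real.rpow_pos_of_pos (by norm_num) _).ne'
  set A := Real.Gamma (1 / 12) with hA
  set B := Real.Gamma (5 / 12) with hB'
  set C := Real.Gamma (3 / 4) with hC
  set E := Real.Gamma (7 / 12) with hE'
  set F := Real.Gamma (1 / 6) with hF'
  set G := Real.Gamma (1 / 4) with hG'
  set H := Real.Gamma (2 / 3) with hH
  set K := Real.Gamma (1 / 3) with hK'
  set L := Real.Gamma (5 / 6) with hL
  set t := (3 : ℝ) ^ ((1 : ℝ) / 4) with ht'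
  -- the relation certificate as a monomial identity
  have key : (A * K * C * L) ^ 2 * ((B * E) * F * (F * H) * G * t) =
      (F * L) ^ 2 * (G * C) * (K * H) * (A * E) * K * (A * B * C * t) := by ring
  rw [hR5, hD22, hR2, hR3, hR4, hD21, h3] at key
  have hX : (π / (Real.sqrt 2 / 2 * (Real.sqrt 3 / 2) + Real.sqrt 2 / 2 * (1 / 2))) * F *
      (K * (2 : ℝ) ^ ((2 : ℝ) / 3) * Real.sqrt π) * G * t ≠ 0 := by
    have : 0 < Real.sqrt π := Real.sqrt_pos.mpr Real.pi_pos
    positivity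
  rw [eq_div_of_mul_eq hX key]
  field_simp
  ring

/-- Normalised form: with `Γ̃ := (2πi)^{-2} Γ(1/12)Γ(4/12)Γ(9/12)Γ(10/12) = −P/(4π²)`,
`Γ̃² = (√3 + 1)·2^{1/6} / (2·3^{1/4})` ( `= (2+√3)^{1/2} 2^{-1/3} 3^{-1/4}` ).
[cite: Deligne1982HodgeCycles, I Thm. 7.15] -/
theorem gammaTilde_fermat12_1_4_9_10_sq :
    (Real.Gamma (1 / 12) * Real.Gamma (4 / 12) * Real.Gamma (9 / 12) * Real.Gamma (10 / 12) /
        (4 * π ^ 2)) ^ 2 =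
      (Real.sqrt 3 + 1) * (2 : ℝ) ^ ((1 : ℝ) / 6) / (2 * (3 : ℝ) ^ ((1 : ℝ) / 4)) := by
  have h := Real_Gamma_prod_fermat12_1_4_9_10_sq
  have ht : (3 : ℝ) ^ ((1 : ℝ) / 4) ≠ 0 := (Real.rpow_pos_of_pos (by norm_num) _).ne'
  have hpi : π ≠ 0 := Real.pi_pos.ne'
  rw [div_pow, h]
  field_simp
  ring

/-- The sign: `Γ̃(1,4,9,10) = −√((√3+1)·2^{1/6}/(2·3^{1/4})) < 0`; in `ℂ`,
`Γ(1/12)Γ(4/12)Γ(9/12)Γ(10/12) / (2πi)² = −√((√3+1)·2^{1/6}/(2·3^{1/4}))`.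
[cite: Deligne1982HodgeCycles, I Thm. 7.15] -/
theorem Complex_gammaTilde_fermat12_1_4_9_10 :
    ((Real.Gamma (1 / 12) * Real.Gamma (4 / 12) * Real.Gamma (9 / 12) * Real.Gamma (10 / 12) : ℝ) : ℂ) /
        (2 * π * Complex.I) ^ 2 =
      -(Real.sqrt ((Real.sqrt 3 + 1) * (2 : ℝ) ^ ((1 : ℝ) / 6) / (2 * (3 : ℝ) ^ ((1 : ℝ) / 4))) : ℝ) := by
  set P := Real.Gamma (1 / 12) * Real.Gamma (4 / 12) * Real.Gamma (9 / 12) * Real.Gamma (10 / 12)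
    with hP
  have hPpos : 0 < P := by
    simp only [hP]
    have := Real.Gamma_pos_of_pos (by norm_num : (0 : ℝ) < 1 / 12)
    have := Real.Gamma_pos_of_pos (by norm_num : (0 : ℝ) < 4 / 12)
    have := Real.Gamma_pos_of_pos (by norm_num : (0 : ℝ) < 9 / 12)
    have := Real.Gamma_pos_of_pos (by norm_num : (0 : ℝ) < 10 / 12)
    positivity
  have hsq : Real.sqrt ((Real.sqrt 3 + 1) * (2 : ℝ) ^ ((1 : ℝ) / 6) / (2 * (3 : ℝ) ^ ((1 : ℝ) / 4))) =
      P / (4 * π ^ 2) := by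
    rw [← gammaTilde_fermat12_1_4_9_10_sq, Real.sqrt_sq (by positivity)]
  rw [hsq]
  have hden : (2 * (π : ℂ) * Complex.I) ^ 2 = -(4 * (π : ℂ) ^ 2) := by
    linear_combination (4 * (π : ℂ) ^ 2) * Complex.I_sq
  have hpi : (π : ℂ) ≠ 0 := Complex.ofReal_ne_zero.mpr Real.pi_pos.ne'
  rw [hden]
  push_cast
  field_simp

end Literature.Analysis.SpecialFunctions
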